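/-
Copyright (c) 2026. All rights reserved.
Released under Apache 2.0 license as described in the file LICENSE.
Authors: abc-iut cell, statement-typer seat abc-iut-L4-t3 (wave 1; gen 9), owner of the §5 interface, over abc-iut-L4-t6's
`⋉`-carrier `archGenuinePlus` and its `η⊢` (`Ltimes/LogFrobeniusArchGenuinePlus(+Eta)`), abc-iut-w5-d038's `ι–η` square
(`ArchimedeanHolGroupPairsEtaShell`) and abc-iut-w6-d025's `ι^{An⊢⊞}` (`LogFrobeniusArchGenuineIotaAnMono`).
-/
import Literature.AnabelianGeometry.AbsoluteAnabelian.Ltimes.LogFrobeniusArchGenuinePlusEta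
import Literature.AnabelianGeometry.AbsoluteAnabelian.Ltimes.LogFrobeniusIotaAnMonoChains
import Literature.AnabelianGeometry.AbsoluteAnabelian.ArchimedeanHolGroupPairsEtaShell
import Literature.AnabelianGeometry.AbsoluteAnabelian.LogFrobeniusArchGenuineIotaSquares
import Literature.AnabelianGeometry.AbsoluteAnabelian.AutHolFieldFunctorOrientationCoherent
import HarnessLib

/-!
# [AbsTopIII] Cor 5.10 (iv)(c) at the archimedean places: the `ι^{An⊢⊞}`-datum and the `ι–η` square `EtaNatural` at the genuine `⋉`-carrier

S. Mochizuki, *Topics in absolute anabelian geometry III*, J. Math. Sci. Univ. Tokyo 22 (2015) [MochizukiAbsTopIII2015];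
manuscript `paper:url-5493eb38cbb7`, read on the page (own render): Cor 5.10 (iv)(c) p. 148 l. 39–51 (the homotopies `η⊢_{v,ν}`,
`(η⊢_{v,ν})⁻¹` "together with … the homotopies … arising from the `ι^{An⊢⊞}_{v,ε}` [cf. Proposition 5.8, (vii)], generate a
contact structure `ℋ_{An⊢}` on `𝔗_{An⊢}`"), Prop 5.8 (vii) p. 142 (`ι^{An⊢⊞}`), Def 3.5 (ii) p. 75 (one homotopy per boundary pair),
Def 5.4 (v) p. 127 (`Γ⃗^×_arc` = the single shell-arrow `k~ ↠ k^×`).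

## What this file proves (cell row «LTIMES-SUCCESSOR», L4-t3's ι-side at the carrier OF RECORD, L4-lead m185; M1 of m170)

At abc-iut-L4-t6's `⋉`-carrier `LogFrobeniusSettingLtimes.archGenuinePlus 𝔄 Vmod isArc` (`𝒩⊞_v := 𝒞^hol_{TH⊞}`, genuine
`𝒩⊞_v → TM⊢ × TB⊞`) with its coherence datum `archGenuinePlus_monoTelecoreCoherence 𝔄 Vmod isArc c hc hcob` (`η⊢` = abc-iut-w5-d038's
`etaTilde`/`etaTimes`, inverted, under an orientation cochain):
* `archGenuinePlus_iotaAnMono` — this lineage's `ι^{An⊢⊞}` add-on INHABITED at the carrier (abc-iut-w6-d025's `TMMono.ιArcTS`: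
  `gammaArc` along the shell-arrow, identity stand-in at a nonarchimedean place of this setting), over `ℰ⊢` on the nose;
  `archGenuinePlus_iotaData` — the same as the `ι`-datum of the coherence datum;
* `archGenuinePlus_squaresCommute` — the `ι^{An⊢⊞}`-squares condition of this lineage's F-0139″ closer (abc-iut-w6-d025's
  `ιArcTS_squaresCommuteF`, by name);
* `archGenuinePlus_iotaCore_shell` — at an all-archimedean index the core `ι⊞` along `k~ ↠ k^×` IS the exponential `ι⊞^×`;
* ★ `archGenuinePlus_etaNatural` — **this lineage's square `EtaNatural` HOLDS at the carrier** (all-archimedean index): along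
  `k~ ↠ k^×`, `η⊢_{v,k~,𝕏} ≫ γ⁰(ι⊞^×)_𝕏 = γ¹(ι^{An⊢⊞})_𝕏 ≫ η⊢_{v,k^×,𝕏}` in `TM⊢ × TB⊞` — `TM⊢`-components on the nose, `TB⊞`-components =
  abc-iut-w5-d038's square `HolTFPair.etaTilde_hom_app_gammaArc` with both `η` inverted;
* `HolRS.exists_archGenuinePlus_etaNatural_geometric` — unconditional at the geometric functor (`exists_orientationCochain_geometric`).
Over the FROZEN interface the `η⊢`-datum is EMPTY at every print-shaped carrier (`isEmpty_monoTelecoreCoherence_archGenuineMonoAnChart`);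
here it is inhabited AND compatible with `ι`.  (Cell note: this seat's parallel carrier `archPlus`, `Ltimes/LogFrobeniusArchPlusCarrier`,
has the same `λ⊞`/`ι⊞`/`𝒩⊞_v → 𝒩⊢⊞_v`/`ψ` and differs only in the placeholder rows `𝒩_v`, `𝒩⊢_v`; the carrier of record is
`archGenuinePlus`, L4-lead m185.)  MODEL-LEVEL; refereed pre-IUT material; nothing here bears on [IUTchIII] Cor. 3.12; no side
taken; typed ≠ proved.
-/

set_option autoImplicit false

noncomputable section

open CategoryTheory

universe u

namespace Literature.AnabelianGeometry.AbsoluteAnabelian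

namespace LogFrobeniusSettingLtimes

variable (𝔄 : AutHolFieldFunctor.{u}) (Vmod : Type (u + 1)) (isArc : Vmod → Bool)
  (c : 𝔄.EA → ℝ) (hc : ∀ X : 𝔄.EA, c X = 1 ∨ c X = -1)
  (hcob : ∀ {X Y : 𝔄.EA} (f : X ⟶ Y), AutHolFieldFunctor.transitionSign f = c X * c Y)

/-! ## The `ι^{An⊢⊞}` add-on at the carrier -/

/-- **The `ι^{An⊢⊞}` add-on INHABITED at `archGenuinePlus`**: along each edge of `Γ⃗^×_w` abc-iut-w6-d025's `ιArcTS` (the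
functorial `gammaArc` along the archimedean shell-arrow), lying over `Th⊢[Z]` ON THE NOSE (`ψ` over `ℰ⊢` is the identity at
the carrier). [cite: MochizukiAbsTopIII2015, Prop 5.8 (vii) p. 142] -/
def archGenuinePlus_iotaAnMono :
    (archGenuinePlus 𝔄 Vmod isArc).IotaAnMono (archGenuinePlus_ψOverIso 𝔄 Vmod isArc) where
  ι w _ _ ε hε := TMMono.ιArcTS (isArc w) ε hε
  ι_over w ν₁ ν₂ ε hε X := by
    change ((TMMono.ιArcTS (isArc w) ε hε).app X).1 = 𝟙 _ ≫ 𝟙 _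
    rw [Category.comp_id]
    rfl

/-- The same datum as the `ι`-datum of abc-iut-L4-t6's coherence datum (`IotaData`). [cite: MochizukiAbsTopIII2015, Prop 5.8 (vii) p. 142] -/
def archGenuinePlus_iotaData :
    (archGenuinePlus_monoTelecoreCoherence 𝔄 Vmod isArc c hc hcob).IotaData :=
  archGenuinePlus_iotaAnMono 𝔄 Vmod isArc

/-- **The `ι^{An⊢⊞}`-squares condition HOLDS at the carrier** (abc-iut-w6-d025's `ιArcTS_squaresCommuteF`: vacuous at an
archimedean place, identities at a nonarchimedean place of this setting). [cite: MochizukiAbsTopIII2015, Def 5.4 (v) p. 127] -/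
theorem archGenuinePlus_squaresCommute : (archGenuinePlus_iotaAnMono 𝔄 Vmod isArc).SquaresCommute :=
  fun w => TMMono.ιArcTS_squaresCommuteF (isArc w)

/-- … and for the `ι`-datum of the coherence datum. [cite: MochizukiAbsTopIII2015, Def 5.4 (v) p. 127] -/
theorem archGenuinePlus_iotaData_squaresCommute :
    (archGenuinePlus_iotaData 𝔄 Vmod isArc c hc hcob).SquaresCommute :=
  archGenuinePlus_squaresCommute 𝔄 Vmod isArc

/-! ## The `ι–η` square at an all-archimedean index -/

variable (V : Type (u + 1))

/-- At an all-archimedean index the core `ι⊞` along the shell-arrow `k~ ↠ k^×` (untwisted) IS the exponential `ι⊞^×` of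
`𝒞^hol_{TH⊞}`, lifted. [cite: MochizukiAbsTopIII2015, Def 5.4 (vii) p. 128] -/
theorem archGenuinePlus_iotaCore_shell (v : V) (hε : LogEdgeTS.InCore (b := true) ArchEdge.shell) :
    (archGenuinePlus 𝔄 V (fun _ => true)).iotaCore v ArchEdge.shell hε = Up.liftT (HolTFPair.iotaTimesPlus 𝔄) :=
  (archGenuinePlus 𝔄 V (fun _ => true)).iotaPre_eq_of_iota_eq v _ _ _ rfl

/-- ★ **The `ι–η` square of Cor 5.10 (iv)(c) (`EtaNatural`) HOLDS at the genuine archimedean `⋉`-carrier** (all-archimedean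
index): for the edge `k~ ↠ k^×` of `Γ⃗^×_arc` and every `TF`-pair `𝕏`, `η⊢_{v,k~,𝕏} ≫ γ⁰_v(ι⊞^×)_𝕏 = γ¹_v(ι^{An⊢⊞})_𝕏 ≫ η⊢_{v,k^×,𝕏}` in
`TM⊢ × TB⊞` — `TM⊢`-components on the nose, `TB⊞`-components by abc-iut-w5-d038's `etaTilde_hom_app_gammaArc`.
[cite: MochizukiAbsTopIII2015, Cor 5.10 (iv)(c) p. 148] -/
theorem archGenuinePlus_etaNatural :
    (archGenuinePlus_monoTelecoreCoherence 𝔄 V (fun _ => true) c hc hcob).EtaNatural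
      (archGenuinePlus_iotaData 𝔄 V (fun _ => true) c hc hcob) := by
  intro v ν₁ ν₂ ε hε y
  match ν₁, ν₂, ε, hε with
  | _, _, ArchEdge.postLogId, hε => exact hε.2.elim
  | _, _, ArchEdge.multToSpaceLink, hε => exact hε.1.elim
  | _, _, ArchEdge.shell, hε =>
    obtain ⟨P⟩ := y
    apply Prod.ext
    · rfl
    · simp only [IotaAnMono.gammaOneApp, gammaZeroApp, archGenuinePlus_iotaCore_shell]
      change (HolTFPair.etaTilde 𝔄 c hc hcob).inv.app P ≫
          TBPlus.uliftFunctor.{u + 1}.map ((HolTHPlusPair.toTBPlus 𝔄).map ((HolTFPair.iotaTimesPlus 𝔄).app P)) =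
        (TMMono.kTilde.map (𝔄.toTMMono.map (𝟙 P.X)) ≫ TMMono.gammaArc.app (𝔄.toTMMono.obj P.X)) ≫
          (HolTFPair.etaTimes 𝔄 c hc hcob).inv.app P
      have sq := HolTFPair.etaTilde_hom_app_gammaArc 𝔄 c hc hcob P
      rw [CategoryTheory.Functor.map_id, CategoryTheory.Functor.map_id, Category.id_comp, ← Iso.app_inv,
        Iso.inv_comp_eq, Iso.app_hom]
      erw [← Category.assoc, sq, Category.assoc, Iso.hom_inv_id_app, Category.comp_id]

end LogFrobeniusSettingLtimes

namespace HolRS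

/-- **At the geometric Aut-holomorphic field functor: a coherence datum `K` at the `⋉`-carrier, its `ι`-datum `I`,
`I.SquaresCommute` and `K.EtaNatural I` — unconditionally.** [cite: MochizukiAbsTopIII2015, Cor 5.10 (iv)(c) p. 148] -/
theorem exists_archGenuinePlus_etaNatural_geometric (Q : ObjectProperty HolRS) (V : Type 1) :
    ∃ (K : (LogFrobeniusSettingLtimes.archGenuinePlus (geometricAutHolFieldFunctor Q) V (fun _ => true)).MonoTelecoreCoherence
        (LogFrobeniusSettingLtimes.archGenuinePlus_monoAnalyticizationHomotopies (geometricAutHolFieldFunctor Q) V _))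
      (I : K.IotaData), I.SquaresCommute ∧ K.EtaNatural I := by
  obtain ⟨c, hc, hcob⟩ := exists_orientationCochain_geometric Q
  exact ⟨LogFrobeniusSettingLtimes.archGenuinePlus_monoTelecoreCoherence _ V _ c hc hcob,
    LogFrobeniusSettingLtimes.archGenuinePlus_iotaData _ V _ c hc hcob,
    LogFrobeniusSettingLtimes.archGenuinePlus_iotaData_squaresCommute _ V _ c hc hcob,
    LogFrobeniusSettingLtimes.archGenuinePlus_etaNatural _ c hc hcob V⟩

end HolRS

end Literature.AnabelianGeometry.AbsoluteAnabelian

end
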